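import Mathlib

/-!
# Quantile-bit door, spectral core: Jensen on pairs of levels and the Hölder split by levels

Support for `QuantileBitPurity.QuantileBitDoor` (stmt-QuantumFields-23925), LINE g12-B of ideator seat
ym-idea-4 (technique card «spectral / trace methods»). Pure finite-dimensional real analysis, no gauge theory:
for non-negative level weights `λ_k` (`k ∈ s`, top level `o`, `λ_k ≤ λ_o`), a real matrix `O_jk` with
`Σ_k O_jk² ≤ 1` (rows) and `Σ_j O_jk² ≤ 1` (columns) — the truncated matrix of a multiplication operator by a
function with `|O| ≤ 1` in the eigenbasis of the transfer matrix — and the two-time level sums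
`I_m = Σ_{j,k} λ_j^m λ_k^{L-m} O_jk²` (`= Tr(M_O T^m M_O T^{L-m})` in the application):

* `pow_sum_le_pow_mul_sum` — weighted power-mean (Jensen) inequality `(Σ w f)^m ≤ (Σ w)^{m-1} Σ w f^m`;
* `levelSum_jensen` — `I_1^m ≤ I_0^{m-1} I_m` (Jensen on the measure `λ_k^L O_jk²` on pairs of levels with the
  function `λ_j/λ_k`), hence persistence at one step propagates to the antipode: `I_m ≥ (1-δ)^m Z` if `I_1 ≥ (1-δ) Z`;
* `levelSum_split` — the Hölder split `I_m ≤ λ_o^L O_oo² + λ_o^L (r^{(L-m)/L} + r^{m/L}) + (Z - λ_o^L)`,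
  `r = (Z - λ_o^L)/λ_o^L`: a nearly pure Gibbs state (`λ_o^L ≈ Z`) factorises across the thermal circle.

[cite: MadrasSokal1988, §2] (Rayleigh-quotient half) · [cite: ReedSimonIV1978, Thm XIII.1] (levels).
-/

set_option autoImplicit false

namespace Summit.QuantumFields.YangMills.Theorems.QuantileBitPurity

open Finset

variable {ι : Type*}

/-- ★ Weighted power mean (Jensen for `x ↦ x^m`): `(Σ w f)^m ≤ (Σ w)^{m-1} · Σ w f^m` for `w, f ≥ 0`, `m ≥ 1`. [folklore] -/
theorem pow_sum_le_pow_mul_sum (s : Finset ι) (w f : ι → ℝ) (hw : ∀ i ∈ s, 0 ≤ w i) (hf : ∀ i ∈ s, 0 ≤ f i)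
    {m : ℕ} (hm : 1 ≤ m) :
    (∑ i ∈ s, w i * f i) ^ m ≤ (∑ i ∈ s, w i) ^ (m - 1) * ∑ i ∈ s, w i * f i ^ m := by
  by_cases hW : ∑ i ∈ s, w i = 0
  · have hwi : ∀ i ∈ s, w i = 0 := fun i hi => (Finset.sum_eq_zero_iff_of_nonneg hw).1 hW i hi
    have h1 : ∑ i ∈ s, w i * f i = 0 := Finset.sum_eq_zero fun i hi => by rw [hwi i hi, zero_mul]
    have h2 : ∑ i ∈ s, w i * f i ^ m = 0 := Finset.sum_eq_zero fun i hi => by rw [hwi i hi, zero_mul]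
    rw [h1, h2, mul_zero]
    exact le_of_eq (zero_pow (by omega))
  · have hWpos : 0 < ∑ i ∈ s, w i := lt_of_le_of_ne (Finset.sum_nonneg hw) (Ne.symm hW)
    set W := ∑ i ∈ s, w i with hWdef
    have hJ := Real.pow_arith_mean_le_arith_mean_pow s (fun i => w i / W) f
      (fun i hi => div_nonneg (hw i hi) hWpos.le) (by rw [← Finset.sum_div]; exact div_self hW) hf m
    have e1 : ∑ i ∈ s, w i / W * f i = (∑ i ∈ s, w i * f i) / W := by
      rw [Finset.sum_div]; exact Finset.sum_congr rfl fun i _ => by ring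
    have e2 : ∑ i ∈ s, w i / W * f i ^ m = (∑ i ∈ s, w i * f i ^ m) / W := by
      rw [Finset.sum_div]; exact Finset.sum_congr rfl fun i _ => by ring
    rw [e1, e2, div_pow, div_le_div_iff₀ (pow_pos hWpos m) hWpos] at hJ
    -- hJ : (∑ w f)^m * W ≤ (∑ w f^m) * W^m
    have hWm : W ^ m = W ^ (m - 1) * W := by
      rw [← pow_succ]; congr 1; omega
    rw [hWm, ← mul_assoc] at hJ
    have h := le_of_mul_le_mul_right hJ hWpos
    linarith [h]

/-- ★ **Jensen on pairs of levels.** `I_1^m ≤ I_0^{m-1} · I_m` for `1 ≤ m ≤ L - 1`, where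
`I_m = Σ_{j,k∈s} λ_j^m λ_k^{L-m} O_jk²` and `I_0 = Σ_{j,k} λ_k^L O_jk²`. [cite: MadrasSokal1988, §2] -/
theorem levelSum_jensen (s : Finset ι) (lam : ι → ℝ) (O : ι → ι → ℝ) {L m : ℕ} (hm : 1 ≤ m) (hmL : m + 1 ≤ L)
    (hlam : ∀ k ∈ s, 0 ≤ lam k) :
    (∑ j ∈ s, ∑ k ∈ s, lam j * lam k ^ (L - 1) * O j k ^ 2) ^ m ≤
      (∑ j ∈ s, ∑ k ∈ s, lam k ^ L * O j k ^ 2) ^ (m - 1) *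
        ∑ j ∈ s, ∑ k ∈ s, lam j ^ m * lam k ^ (L - m) * O j k ^ 2 := by
  classical
  -- the measure `w (j,k) = λ_k^L O_jk²` and the function `f (j,k) = λ_j / λ_k` on `s ×ˢ s`
  have key := pow_sum_le_pow_mul_sum (s ×ˢ s) (fun p => lam p.2 ^ L * O p.1 p.2 ^ 2) (fun p => lam p.1 / lam p.2)
    (fun p hp => mul_nonneg (pow_nonneg (hlam _ (Finset.mem_product.1 hp).2) _) (sq_nonneg _))
    (fun p hp => div_nonneg (hlam _ (Finset.mem_product.1 hp).1) (hlam _ (Finset.mem_product.1 hp).2)) hm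
  have hL2 : 2 ≤ L := by omega
  -- termwise identities
  have t1 : ∀ j ∈ s, ∀ k ∈ s, lam k ^ L * O j k ^ 2 * (lam j / lam k) = lam j * lam k ^ (L - 1) * O j k ^ 2 := by
    intro j _ k _
    by_cases hk : lam k = 0
    · rw [hk, zero_pow (by omega), zero_pow (by omega)]; ring
    · have : lam k ^ L = lam k ^ (L - 1) * lam k := by rw [← pow_succ]; congr 1; omega
      rw [this]; field_simp
  have t2 : ∀ j ∈ s, ∀ k ∈ s, lam k ^ L * O j k ^ 2 * (lam j / lam k) ^ m = lam j ^ m * lam k ^ (L - m) * O j k ^ 2 := by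
    intro j _ k _
    by_cases hk : lam k = 0
    · rw [hk, zero_pow (by omega), zero_pow (by omega)]; ring
    · have : lam k ^ L = lam k ^ (L - m) * lam k ^ m := by rw [← pow_add]; congr 1; omega
      rw [this, div_pow]; field_simp
  have s1 : ∑ p ∈ s ×ˢ s, lam p.2 ^ L * O p.1 p.2 ^ 2 * (lam p.1 / lam p.2) =
      ∑ j ∈ s, ∑ k ∈ s, lam j * lam k ^ (L - 1) * O j k ^ 2 := by
    rw [Finset.sum_product]; exact Finset.sum_congr rfl fun j hj => Finset.sum_congr rfl fun k hk => t1 j hj k hk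
  have s2 : ∑ p ∈ s ×ˢ s, lam p.2 ^ L * O p.1 p.2 ^ 2 * (lam p.1 / lam p.2) ^ m =
      ∑ j ∈ s, ∑ k ∈ s, lam j ^ m * lam k ^ (L - m) * O j k ^ 2 := by
    rw [Finset.sum_product]; exact Finset.sum_congr rfl fun j hj => Finset.sum_congr rfl fun k hk => t2 j hj k hk
  have s0 : ∑ p ∈ s ×ˢ s, lam p.2 ^ L * O p.1 p.2 ^ 2 = ∑ j ∈ s, ∑ k ∈ s, lam k ^ L * O j k ^ 2 := by
    rw [Finset.sum_product]
  rw [s1, s2, s0] at key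
  exact key

/-- Persistence propagates to the antipode: if `I_1 ≥ (1-δ) Z` with `Z = Σ_k λ_k^L`, columns `Σ_j O_jk² ≤ 1`
and `0 ≤ 1 - δ`, then `I_m ≥ (1-δ)^m Z` (`1 ≤ m ≤ L-1`). [cite: MadrasSokal1988, §2] -/
theorem levelSum_ge_of_oneStep (s : Finset ι) (lam : ι → ℝ) (O : ι → ι → ℝ) {L m : ℕ} (hm : 1 ≤ m)
    (hmL : m + 1 ≤ L) (hlam : ∀ k ∈ s, 0 ≤ lam k) (hcol : ∀ k ∈ s, ∑ j ∈ s, O j k ^ 2 ≤ 1) {δ : ℝ}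
    (hδ : 0 ≤ 1 - δ)
    (h1 : (1 - δ) * ∑ k ∈ s, lam k ^ L ≤ ∑ j ∈ s, ∑ k ∈ s, lam j * lam k ^ (L - 1) * O j k ^ 2) :
    (1 - δ) ^ m * ∑ k ∈ s, lam k ^ L ≤ ∑ j ∈ s, ∑ k ∈ s, lam j ^ m * lam k ^ (L - m) * O j k ^ 2 := by
  classical
  set Z := ∑ k ∈ s, lam k ^ L with hZ
  set I0 := ∑ j ∈ s, ∑ k ∈ s, lam k ^ L * O j k ^ 2 with hI0
  set I1 := ∑ j ∈ s, ∑ k ∈ s, lam j * lam k ^ (L - 1) * O j k ^ 2 with hI1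
  set Im := ∑ j ∈ s, ∑ k ∈ s, lam j ^ m * lam k ^ (L - m) * O j k ^ 2 with hIm
  have hZnn : 0 ≤ Z := Finset.sum_nonneg fun k hk => pow_nonneg (hlam k hk) _
  have hI0Z : I0 ≤ Z := by
    rw [hI0, Finset.sum_comm]
    refine Finset.sum_le_sum fun k hk => ?_
    rw [← Finset.mul_sum]
    calc lam k ^ L * ∑ j ∈ s, O j k ^ 2 ≤ lam k ^ L * 1 := mul_le_mul_of_nonneg_left (hcol k hk) (pow_nonneg (hlam k hk) _)
      _ = lam k ^ L := mul_one _
  have hI0nn : 0 ≤ I0 := Finset.sum_nonneg fun j _ => Finset.sum_nonneg fun k hk => mul_nonneg (pow_nonneg (hlam k hk) _) (sq_nonneg _)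
  have hImnn : 0 ≤ Im := Finset.sum_nonneg fun j hj => Finset.sum_nonneg fun k hk =>
    mul_nonneg (mul_nonneg (pow_nonneg (hlam j hj) _) (pow_nonneg (hlam k hk) _)) (sq_nonneg _)
  have hJ : I1 ^ m ≤ I0 ^ (m - 1) * Im := levelSum_jensen s lam O hm hmL hlam
  have h1' : (1 - δ) * Z ≤ I1 := h1
  have hlow : ((1 - δ) * Z) ^ m ≤ I1 ^ m := pow_le_pow_left₀ (mul_nonneg hδ hZnn) h1' m
  -- ((1-δ) Z)^m ≤ I0^{m-1} Im ≤ Z^{m-1} Im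
  have hup : I0 ^ (m - 1) * Im ≤ Z ^ (m - 1) * Im :=
    mul_le_mul_of_nonneg_right (pow_le_pow_left₀ hI0nn hI0Z _) hImnn
  have hchain : ((1 - δ) * Z) ^ m ≤ Z ^ (m - 1) * Im := hlow.trans (hJ.trans hup)
  rw [mul_pow] at hchain
  -- (1-δ)^m Z^m ≤ Z^{m-1} Im ⇒ (1-δ)^m Z ≤ Im (divide by Z^{m-1} when Z > 0)
  rcases eq_or_lt_of_le hZnn with hZ0 | hZpos
  · rw [← hZ0, mul_zero]; exact hImnn
  · have hZm : Z ^ m = Z ^ (m - 1) * Z := by rw [← pow_succ]; congr 1; omega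
    rw [hZm] at hchain
    have hp : 0 < Z ^ (m - 1) := pow_pos hZpos _
    -- (1-δ)^m * (Z^{m-1} * Z) ≤ Z^{m-1} * Im
    have : Z ^ (m - 1) * ((1 - δ) ^ m * Z) ≤ Z ^ (m - 1) * Im := by
      calc Z ^ (m - 1) * ((1 - δ) ^ m * Z) = (1 - δ) ^ m * (Z ^ (m - 1) * Z) := by ring
        _ ≤ Z ^ (m - 1) * Im := hchain
    exact le_of_mul_le_mul_left this hp

/-- Hölder with total weight at most one: `Σ w x^θ ≤ (Σ w x)^θ` for `0 ≤ w`, `Σ w ≤ 1`, `w ≤ 1`, `0 ≤ x`, `0 < θ ≤ 1`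
— via concavity of `x ↦ x^θ`. [folklore] -/
theorem sum_mul_rpow_le (s : Finset ι) (w x : ι → ℝ) (hw : ∀ i ∈ s, 0 ≤ w i) (hW : ∑ i ∈ s, w i ≤ 1)
    (hx : ∀ i ∈ s, 0 ≤ x i) {θ : ℝ} (hθ0 : 0 < θ) (hθ1 : θ ≤ 1) :
    ∑ i ∈ s, w i * x i ^ θ ≤ (∑ i ∈ s, w i * x i) ^ θ := by
  by_cases hWz : ∑ i ∈ s, w i = 0
  · have hwi : ∀ i ∈ s, w i = 0 := fun i hi => (Finset.sum_eq_zero_iff_of_nonneg hw).1 hWz i hi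
    have h1 : ∑ i ∈ s, w i * x i ^ θ = 0 := Finset.sum_eq_zero fun i hi => by rw [hwi i hi, zero_mul]
    have h2 : ∑ i ∈ s, w i * x i = 0 := Finset.sum_eq_zero fun i hi => by rw [hwi i hi, zero_mul]
    rw [h1, h2]; exact Real.rpow_nonneg le_rfl _
  · set W := ∑ i ∈ s, w i with hWdef
    have hWpos : 0 < W := lt_of_le_of_ne (Finset.sum_nonneg hw) (Ne.symm hWz)
    -- Jensen for the concave function t ↦ t^θ on [0, ∞) with weights w_i / W
    have hconc : ConcaveOn ℝ (Set.Ici (0 : ℝ)) (fun t : ℝ => t ^ θ) := by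
      rcases eq_or_lt_of_le hθ1 with h1 | h1
      · rw [h1]; simp only [Real.rpow_one]; exact concaveOn_id (convex_Ici 0)
      · exact (Real.strictConcaveOn_rpow hθ0 h1).concaveOn
    have hJ := hconc.le_map_sum (t := s) (w := fun i => w i / W) (p := x)
      (fun i hi => div_nonneg (hw i hi) hWpos.le) (by rw [← Finset.sum_div]; exact div_self hWz)
      (fun i hi => Set.mem_Ici.2 (hx i hi))
    simp only [smul_eq_mul] at hJ
    -- hJ : ∑ (w i / W) * x i ^ θ ≤ (∑ (w i / W) * x i) ^ θ
    have e1 : ∑ i ∈ s, w i / W * x i ^ θ = (∑ i ∈ s, w i * x i ^ θ) / W := by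
      rw [Finset.sum_div]; exact Finset.sum_congr rfl fun i _ => by ring
    have e2 : ∑ i ∈ s, w i / W * x i = (∑ i ∈ s, w i * x i) / W := by
      rw [Finset.sum_div]; exact Finset.sum_congr rfl fun i _ => by ring
    rw [e1, e2] at hJ
    have hSnn : 0 ≤ ∑ i ∈ s, w i * x i := Finset.sum_nonneg fun i hi => mul_nonneg (hw i hi) (hx i hi)
    have hW1 : W ≤ 1 := hW
    -- (S/W)^θ = S^θ / W^θ and W^θ ≥ W (W ≤ 1, θ ≤ 1), so S_θ ≤ W · S^θ / W^θ ≤ S^θ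
    rw [Real.div_rpow hSnn hWpos.le] at hJ
    have hWθ : W ≤ W ^ θ := by
      have := Real.rpow_le_rpow_of_exponent_ge hWpos hW1 hθ1
      simpa using this
    have hWθpos : 0 < W ^ θ := Real.rpow_pos_of_pos hWpos _
    rw [div_le_div_iff₀ hWpos hWθpos] at hJ
    -- hJ : (∑ w x^θ) * W^θ ≤ (∑ w x)^θ * W
    have hR : 0 ≤ (∑ i ∈ s, w i * x i) ^ θ := Real.rpow_nonneg hSnn _
    have hL : 0 ≤ ∑ i ∈ s, w i * x i ^ θ := Finset.sum_nonneg fun i hi => mul_nonneg (hw i hi) (Real.rpow_nonneg (hx i hi) _)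
    nlinarith [mul_le_mul_of_nonneg_left hWθ hL, mul_le_mul_of_nonneg_left hWθ hR]

/-- `x^n = (x^L)^{n/L}` for `x ≥ 0`, `L ≥ 1`. [folklore] -/
theorem pow_eq_pow_rpow_div {x : ℝ} (hx : 0 ≤ x) {L : ℕ} (n : ℕ) (hL : 0 < L) :
    x ^ n = (x ^ L) ^ ((n : ℝ) / L) := by
  have hL' : ((L : ℕ) : ℝ) ≠ 0 := by exact_mod_cast hL.ne'
  rw [← Real.rpow_natCast x L, ← Real.rpow_mul hx]
  have : ((L : ℕ) : ℝ) * ((n : ℝ) / L) = (n : ℝ) := by field_simp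
  rw [this, Real.rpow_natCast]

/-- Young's inequality for level weights: `λ_j^m λ_k^{L-m} ≤ (m/L) λ_j^L + ((L-m)/L) λ_k^L`. [folklore] -/
theorem pow_mul_pow_le_young {a b : ℝ} (ha : 0 ≤ a) (hb : 0 ≤ b) {L m : ℕ} (hmL : m ≤ L) (hL : 0 < L) :
    a ^ m * b ^ (L - m) ≤ (m : ℝ) / L * a ^ L + ((L - m : ℕ) : ℝ) / L * b ^ L := by
  have hL' : ((L : ℕ) : ℝ) ≠ 0 := by exact_mod_cast hL.ne'
  have hw : (m : ℝ) / L + ((L - m : ℕ) : ℝ) / L = 1 := by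
    rw [← add_div, div_eq_one_iff_eq hL']; push_cast [Nat.cast_sub hmL]; ring
  have h := Real.geom_mean_le_arith_mean2_weighted (by positivity) (by positivity) (pow_nonneg ha L) (pow_nonneg hb L) hw
  rw [← pow_eq_pow_rpow_div ha m hL, ← pow_eq_pow_rpow_div hb (L - m) hL] at h
  exact h

/-- ★ **The Hölder split of the two-time level sum by levels.** With top level `o` (`0 < λ_o`, `λ_k ≤ λ_o`),
rows and columns of `O_jk²` summing to at most one, `R = Σ_{k ≠ o} λ_k^L` and `r = R / λ_o^L`, for `1 ≤ m ≤ L-1`: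
`I_m ≤ λ_o^L O_oo² + λ_o^L (r^{(L-m)/L} + r^{m/L}) + R`.
In the application (`λ_o^L = p₀ Z`, `R = (1-p₀) Z`) this reads `I_m / Z ≤ O_oo² + r^{(L-m)/L} + r^{m/L} + (1-p₀)`:
a nearly pure Gibbs state factorises across the thermal circle. [cite: ReedSimonIV1978, Thm XIII.1] -/
theorem levelSum_split [DecidableEq ι] (s : Finset ι) (lam : ι → ℝ) (O : ι → ι → ℝ) {L m : ℕ} (hm : 1 ≤ m)
    (hmL : m + 1 ≤ L) {o : ι} (ho : o ∈ s) (hlam : ∀ k ∈ s, 0 ≤ lam k) (hlam0 : 0 < lam o)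
    (hrow : ∀ j ∈ s, ∑ k ∈ s, O j k ^ 2 ≤ 1) (hcol : ∀ k ∈ s, ∑ j ∈ s, O j k ^ 2 ≤ 1) :
    ∑ j ∈ s, ∑ k ∈ s, lam j ^ m * lam k ^ (L - m) * O j k ^ 2 ≤
      lam o ^ L * O o o ^ 2 +
        lam o ^ L * (((∑ k ∈ s.erase o, lam k ^ L) / lam o ^ L) ^ (((L - m : ℕ) : ℝ) / L) +
          ((∑ k ∈ s.erase o, lam k ^ L) / lam o ^ L) ^ ((m : ℝ) / L)) +
        ∑ k ∈ s.erase o, lam k ^ L := by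
  have hL : 0 < L := by omega
  have hL' : (0 : ℝ) < L := by exact_mod_cast hL
  have hmL' : m ≤ L := by omega
  set E := s.erase o with hE
  set R := ∑ k ∈ E, lam k ^ L with hR
  set T : ι → ι → ℝ := fun j k => lam j ^ m * lam k ^ (L - m) * O j k ^ 2 with hT
  have hEs : E ⊆ s := Finset.erase_subset _ _
  have hlamE : ∀ k ∈ E, 0 ≤ lam k := fun k hk => hlam k (hEs hk)
  have hloL : 0 < lam o ^ L := pow_pos hlam0 _
  have hRnn : 0 ≤ R := Finset.sum_nonneg fun k hk => pow_nonneg (hlamE k hk) _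
  have hO2le : ∀ j ∈ s, ∀ k ∈ s, O j k ^ 2 ≤ 1 := fun j hj k hk =>
    (Finset.single_le_sum (f := fun k => O j k ^ 2) (fun k _ => sq_nonneg _) hk).trans (hrow j hj)
  -- decomposition of the double sum
  have hsplit : ∑ j ∈ s, ∑ k ∈ s, T j k = T o o + ∑ k ∈ E, T o k + (∑ j ∈ E, T j o + ∑ j ∈ E, ∑ k ∈ E, T j k) := by
    rw [← Finset.add_sum_erase s _ ho, ← Finset.add_sum_erase s _ ho]
    congr 1
    rw [← Finset.sum_add_distrib]
    exact Finset.sum_congr rfl fun j _ => (Finset.add_sum_erase s _ ho).symm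
  -- (a) the top-top term
  have ha : T o o = lam o ^ L * O o o ^ 2 := by
    simp only [hT]; rw [← pow_add, Nat.add_sub_cancel' hmL']
  -- the ratio variables x_k = (λ_k/λ_o)^L and their sum r = R / λ_o^L
  have hx : ∀ k ∈ E, 0 ≤ (lam k / lam o) ^ L := fun k hk => pow_nonneg (div_nonneg (hlamE k hk) hlam0.le) _
  have hxsum : ∑ k ∈ E, (lam k / lam o) ^ L = R / lam o ^ L := by
    rw [hR, Finset.sum_div]; exact Finset.sum_congr rfl fun k _ => by rw [div_pow]
  -- (b) the top row: Σ_{k≠o} λ_o^m λ_k^{L-m} O_ok² ≤ λ_o^L r^{(L-m)/L}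
  have hb : ∑ k ∈ E, T o k ≤ lam o ^ L * (R / lam o ^ L) ^ (((L - m : ℕ) : ℝ) / L) := by
    have e : ∀ k ∈ E, T o k = lam o ^ L * (O o k ^ 2 * ((lam k / lam o) ^ L) ^ (((L - m : ℕ) : ℝ) / L)) := by
      intro k hk
      simp only [hT]
      rw [← pow_eq_pow_rpow_div (div_nonneg (hlamE k hk) hlam0.le) (L - m) hL, div_pow]
      have hne : lam o ^ (L - m) ≠ 0 := pow_ne_zero _ hlam0.ne'
      have : lam o ^ L = lam o ^ m * lam o ^ (L - m) := by rw [← pow_add, Nat.add_sub_cancel' hmL']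
      rw [this]; field_simp
    rw [Finset.sum_congr rfl e, ← Finset.mul_sum]
    refine mul_le_mul_of_nonneg_left ?_ hloL.le
    have hθ0 : (0 : ℝ) < ((L - m : ℕ) : ℝ) / L := div_pos (by exact_mod_cast (show 0 < L - m by omega)) hL'
    have hθ1 : ((L - m : ℕ) : ℝ) / L ≤ 1 := by rw [div_le_one hL']; exact_mod_cast (Nat.sub_le L m)
    have hW : ∑ k ∈ E, O o k ^ 2 ≤ 1 :=
      (Finset.sum_le_sum_of_subset_of_nonneg hEs fun k _ _ => sq_nonneg _).trans (hrow o ho)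
    refine (sum_mul_rpow_le E (fun k => O o k ^ 2) (fun k => (lam k / lam o) ^ L) (fun k _ => sq_nonneg _) hW hx hθ0 hθ1).trans ?_
    refine Real.rpow_le_rpow (Finset.sum_nonneg fun k hk => mul_nonneg (sq_nonneg _) (hx k hk)) ?_ hθ0.le
    rw [← hxsum]
    exact Finset.sum_le_sum fun k hk => by
      have := hO2le o ho k (hEs hk)
      nlinarith [hx k hk]
  -- (c) the top column: Σ_{j≠o} λ_j^m λ_o^{L-m} O_jo² ≤ λ_o^L r^{m/L}
  have hc : ∑ j ∈ E, T j o ≤ lam o ^ L * (R / lam o ^ L) ^ ((m : ℝ) / L) := by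
    have e : ∀ j ∈ E, T j o = lam o ^ L * (O j o ^ 2 * ((lam j / lam o) ^ L) ^ ((m : ℝ) / L)) := by
      intro j hj
      simp only [hT]
      rw [← pow_eq_pow_rpow_div (div_nonneg (hlamE j hj) hlam0.le) m hL, div_pow]
      have hne : lam o ^ m ≠ 0 := pow_ne_zero _ hlam0.ne'
      have : lam o ^ L = lam o ^ m * lam o ^ (L - m) := by rw [← pow_add, Nat.add_sub_cancel' hmL']
      rw [this]; field_simp
    rw [Finset.sum_congr rfl e, ← Finset.mul_sum]
    refine mul_le_mul_of_nonneg_left ?_ hloL.le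
    have hθ0 : (0 : ℝ) < (m : ℝ) / L := div_pos (by exact_mod_cast (show 0 < m by omega)) hL'
    have hθ1 : (m : ℝ) / L ≤ 1 := by rw [div_le_one hL']; exact_mod_cast hmL'
    have hW : ∑ j ∈ E, O j o ^ 2 ≤ 1 :=
      (Finset.sum_le_sum_of_subset_of_nonneg hEs fun j _ _ => sq_nonneg _).trans (hcol o ho)
    refine (sum_mul_rpow_le E (fun j => O j o ^ 2) (fun j => (lam j / lam o) ^ L) (fun j _ => sq_nonneg _) hW hx hθ0 hθ1).trans ?_
    refine Real.rpow_le_rpow (Finset.sum_nonneg fun j hj => mul_nonneg (sq_nonneg _) (hx j hj)) ?_ hθ0.le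
    rw [← hxsum]
    exact Finset.sum_le_sum fun j hj => by
      have h1 : O j o ^ 2 ≤ 1 := (Finset.single_le_sum (f := fun j => O j o ^ 2) (fun j _ => sq_nonneg _) (hEs hj)).trans (hcol o ho)
      nlinarith [hx j hj]
  -- (d) the off-top block by Young: ≤ (m/L) R + ((L-m)/L) R = R
  have hd : ∑ j ∈ E, ∑ k ∈ E, T j k ≤ R := by
    have hy : ∀ j ∈ E, ∀ k ∈ E, T j k ≤ ((m : ℝ) / L * lam j ^ L + ((L - m : ℕ) : ℝ) / L * lam k ^ L) * O j k ^ 2 :=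
      fun j hj k hk => mul_le_mul_of_nonneg_right (pow_mul_pow_le_young (hlamE j hj) (hlamE k hk) hmL' hL) (sq_nonneg _)
    refine (Finset.sum_le_sum fun j hj => Finset.sum_le_sum fun k hk => hy j hj k hk).trans ?_
    have hrowE : ∀ j ∈ E, ∑ k ∈ E, O j k ^ 2 ≤ 1 := fun j hj =>
      (Finset.sum_le_sum_of_subset_of_nonneg hEs fun k _ _ => sq_nonneg _).trans (hrow j (hEs hj))
    have hcolE : ∀ k ∈ E, ∑ j ∈ E, O j k ^ 2 ≤ 1 := fun k hk =>
      (Finset.sum_le_sum_of_subset_of_nonneg hEs fun j _ _ => sq_nonneg _).trans (hcol k (hEs hk))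
    have hsum1 : ∑ j ∈ E, ∑ k ∈ E, (m : ℝ) / L * lam j ^ L * O j k ^ 2 ≤ (m : ℝ) / L * R := by
      rw [hR, Finset.mul_sum]
      refine Finset.sum_le_sum fun j hj => ?_
      rw [← Finset.mul_sum]
      calc (m : ℝ) / L * lam j ^ L * ∑ k ∈ E, O j k ^ 2 ≤ (m : ℝ) / L * lam j ^ L * 1 :=
            mul_le_mul_of_nonneg_left (hrowE j hj) (mul_nonneg (by positivity) (pow_nonneg (hlamE j hj) _))
        _ = (m : ℝ) / L * lam j ^ L := mul_one _
    have hsum2 : ∑ j ∈ E, ∑ k ∈ E, ((L - m : ℕ) : ℝ) / L * lam k ^ L * O j k ^ 2 ≤ ((L - m : ℕ) : ℝ) / L * R := by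
      rw [Finset.sum_comm, hR, Finset.mul_sum]
      refine Finset.sum_le_sum fun k hk => ?_
      rw [← Finset.mul_sum]
      calc ((L - m : ℕ) : ℝ) / L * lam k ^ L * ∑ j ∈ E, O j k ^ 2 ≤ ((L - m : ℕ) : ℝ) / L * lam k ^ L * 1 :=
            mul_le_mul_of_nonneg_left (hcolE k hk) (mul_nonneg (by positivity) (pow_nonneg (hlamE k hk) _))
        _ = ((L - m : ℕ) : ℝ) / L * lam k ^ L := mul_one _
    have hsplit2 : ∑ j ∈ E, ∑ k ∈ E, ((m : ℝ) / L * lam j ^ L + ((L - m : ℕ) : ℝ) / L * lam k ^ L) * O j k ^ 2 =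
        ∑ j ∈ E, ∑ k ∈ E, (m : ℝ) / L * lam j ^ L * O j k ^ 2 +
          ∑ j ∈ E, ∑ k ∈ E, ((L - m : ℕ) : ℝ) / L * lam k ^ L * O j k ^ 2 := by
      rw [← Finset.sum_add_distrib]
      refine Finset.sum_congr rfl fun j _ => ?_
      rw [← Finset.sum_add_distrib]
      exact Finset.sum_congr rfl fun k _ => by ring
    rw [hsplit2]
    have hw : (m : ℝ) / L + ((L - m : ℕ) : ℝ) / L = 1 := by
      rw [← add_div, div_eq_one_iff_eq hL'.ne']; push_cast [Nat.cast_sub hmL']; ring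
    calc _ ≤ (m : ℝ) / L * R + ((L - m : ℕ) : ℝ) / L * R := add_le_add hsum1 hsum2
      _ = R := by rw [← add_mul, hw, one_mul]
  -- assemble
  have hI : ∑ j ∈ s, ∑ k ∈ s, lam j ^ m * lam k ^ (L - m) * O j k ^ 2 = ∑ j ∈ s, ∑ k ∈ s, T j k := rfl
  rw [hI, hsplit, ha]
  nlinarith [hb, hc, hd]

/-- ★ **Spectral core of the quantile-bit door.** One-step persistence `I_1 ≥ (1-δ) Z` forces, at every
intermediate slot `1 ≤ m ≤ L-1`,
`(1-δ)^m Z ≤ λ_o^L O_oo² + λ_o^L (r^{(L-m)/L} + r^{m/L}) + R`, `R = Σ_{k≠o} λ_k^L = Z - λ_o^L`, `r = R/λ_o^L`;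
read with `p₀ = λ_o^L / Z`: `(1-δ)^m ≤ p₀ O_oo² + p₀ (r^{(L-m)/L} + r^{m/L}) + (1 - p₀)`, so a persistent bit with
`O_oo² < 1` bounds the top weight `p₀` away from one. [cite: MadrasSokal1988, §2] [cite: ReedSimonIV1978, Thm XIII.1] -/
theorem purity_split_core [DecidableEq ι] (s : Finset ι) (lam : ι → ℝ) (O : ι → ι → ℝ) {L m : ℕ} (hm : 1 ≤ m)
    (hmL : m + 1 ≤ L) {o : ι} (ho : o ∈ s) (hlam : ∀ k ∈ s, 0 ≤ lam k) (hlam0 : 0 < lam o)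
    (hrow : ∀ j ∈ s, ∑ k ∈ s, O j k ^ 2 ≤ 1) (hcol : ∀ k ∈ s, ∑ j ∈ s, O j k ^ 2 ≤ 1) {δ : ℝ} (hδ : 0 ≤ 1 - δ)
    (h1 : (1 - δ) * ∑ k ∈ s, lam k ^ L ≤ ∑ j ∈ s, ∑ k ∈ s, lam j * lam k ^ (L - 1) * O j k ^ 2) :
    (1 - δ) ^ m * ∑ k ∈ s, lam k ^ L ≤
      lam o ^ L * O o o ^ 2 +
        lam o ^ L * (((∑ k ∈ s.erase o, lam k ^ L) / lam o ^ L) ^ (((L - m : ℕ) : ℝ) / L) +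
          ((∑ k ∈ s.erase o, lam k ^ L) / lam o ^ L) ^ ((m : ℝ) / L)) +
        ∑ k ∈ s.erase o, lam k ^ L :=
  (levelSum_ge_of_oneStep s lam O hm hmL hlam hcol hδ h1).trans (levelSum_split s lam O hm hmL ho hlam hlam0 hrow hcol)

/-- The slice marginal controls the top diagonal entry: with `p_k = λ_k^L / Z` and `|d_k| ≤ 1`,
`|d_o| ≤ |Σ_k p_k d_k| + 2 (1 - p_o)`. [folklore] -/
theorem top_diag_le_mean [DecidableEq ι] (s : Finset ι) (p d : ι → ℝ) {o : ι} (ho : o ∈ s) (hp : ∀ k ∈ s, 0 ≤ p k)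
    (hp1 : ∑ k ∈ s, p k = 1) (hd : ∀ k ∈ s, |d k| ≤ 1) :
    |d o| ≤ |∑ k ∈ s, p k * d k| + 2 * (1 - p o) := by
  have hsplit : ∑ k ∈ s, p k * d k = p o * d o + ∑ k ∈ s.erase o, p k * d k := (Finset.add_sum_erase s _ ho).symm
  have hrest : ∑ k ∈ s.erase o, p k = 1 - p o := by
    have := Finset.add_sum_erase s p ho; linarith
  have hbound : |∑ k ∈ s.erase o, p k * d k| ≤ 1 - p o := by
    rw [← hrest]
    refine (Finset.abs_sum_le_sum_abs _ _).trans (Finset.sum_le_sum fun k hk => ?_)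
    rw [abs_mul, abs_of_nonneg (hp k (Finset.mem_of_mem_erase hk))]
    calc p k * |d k| ≤ p k * 1 := mul_le_mul_of_nonneg_left (hd k (Finset.mem_of_mem_erase hk)) (hp k (Finset.mem_of_mem_erase hk))
      _ = p k := mul_one _
  have hdo : |d o| ≤ 1 := hd o ho
  have hpo : 0 ≤ p o := hp o ho
  have hpo1 : p o ≤ 1 := by rw [← hp1]; exact Finset.single_le_sum hp ho
  -- d_o = (Σ p d) - Σ_{k≠o} p_k d_k + (1 - p_o) d_o
  have : d o = (∑ k ∈ s, p k * d k) - ∑ k ∈ s.erase o, p k * d k + (1 - p o) * d o := by rw [hsplit]; ring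
  rw [this]
  have h3 : |(1 - p o) * d o| ≤ (1 - p o) * 1 := by
    rw [abs_mul, abs_of_nonneg (by linarith : 0 ≤ 1 - p o)]
    exact mul_le_mul_of_nonneg_left hdo (by linarith)
  calc |(∑ k ∈ s, p k * d k) - ∑ k ∈ s.erase o, p k * d k + (1 - p o) * d o|
      ≤ |(∑ k ∈ s, p k * d k) - ∑ k ∈ s.erase o, p k * d k| + |(1 - p o) * d o| := abs_add_le _ _
    _ ≤ (|∑ k ∈ s, p k * d k| + |∑ k ∈ s.erase o, p k * d k|) + (1 - p o) * 1 := add_le_add (abs_sub _ _) h3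
    _ ≤ |∑ k ∈ s, p k * d k| + 2 * (1 - p o) := by linarith [hbound]

end Summit.QuantumFields.YangMills.Theorems.QuantileBitPurity
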